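import Summits.NavierStokesRegularity.NavierStokesRegularity.Theorems.ScalingDefectPeepholeDoorSerrinPointwise
import Summits.NavierStokesRegularity.NavierStokesRegularity.Theorems.ScalingDefectPeepholeDoorSerrinSlab
import HarnessLib

/-!
# ScalingDefectPeepholeDoorSerrinSpinDuality — door S30 «ScalingDefectPeepholeDoor», effective plate E0 (step E1c):
# the PRESSURE-FREE duality bound for the spin entries of a bounded distributional Navier–Stokes solution

Third file of the pressure-free chain (`…SerrinPointwise`, `…SerrinSlab`).  **For a distributional
Navier–Stokes solution `(u, p)` (`ν = 1`, no force) on the centred cylinder `Q*_R(z₀)`, `z₀ = (-R², 0)` —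
i.e. `]-2R², 0[ × B(0, R)` — with `|u| ≤ M` a.e. and a (merely locally integrable) weak spatial gradient
`G`, every spin entry `A_{bc} = G_{bc} - G_{cb} = ∂_c u_b - ∂_b u_c` satisfies
`|∫ ξ A_{bc}| ≤ C (|M| + M²) ‖ξ‖₂` for every test function `ξ` on an inner cylinder `]-L', 0[ × B(0, ρ')`
sharing the top, `C = C(R, L', ρ')`.**  No integrability of `G` and nothing about `p` is assumed: the
pressure is annihilated by testing the momentum equation against the divergence-free fields
`-(∂_cψ) e_b + (∂_bψ) e_c` (the tree's `NSSpinHeat.momentum_pairField`), and with `ψ = φ 𝒰[ξ]` (`φ` a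
cut-off reaching over the top, `𝒰` the backward caloric Duhamel integral), `∂ₜψ + Δψ = -ξ + ϑ`,
`ϑ = (∂ₜφ + Δφ)𝒰[ξ] + 2∇φ·∇𝒰[ξ]`, so that
`∫ ξ A_{bc} = -∫ ∂_cϑ u_b + ∫ ∂_bϑ u_c - ∫ Σⱼ ∂ⱼ∂_cψ uⱼu_b + ∫ Σⱼ ∂ⱼ∂_bψ uⱼu_c`: every term is `u` or
`u ⊗ u` (bounded) against at most SECOND derivatives of `𝒰[ξ]`, which the `L²` energy estimate and the
`L²` maximal regularity of the heat equation bound by `‖ξ‖₂` (Serrin 1962; Chen–Strain–Tsai–Yau 2009,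
Lemma A.2; the argument is the tree's `HeatDivForm.heatDivForm_gradient_L2_top` one derivative lower).

Door S30 is a regularity CRITERION inside a HYPOTHETICAL local Type-I blow-up; item 0056 `NoTypeII`
stays OPEN; nothing here bears on NS regularity itself.
-/

noncomputable section

set_option linter.dupNamespace false

namespace Summit.NavierStokesRegularity.NavierStokesRegularity.Theorems.ScalingDefectPeepholeDoor

namespace Serrin

open MeasureTheory Set Function Filter Topology TopologicalSpace Metric InnerProductSpace
open scoped NNReal ENNReal RealInnerProductSpace Laplacian ContDiff
open Literature.Analysis Literature.Analysis.FluidPDE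

/-! ### The duality bound -/

set_option maxHeartbeats 1600000 in
/-- **The duality bound** (module docstring). On the centred cylinder `Q = Q*_R(-R², 0) =
]-2R², 0[ × B(0, R)`: for a distributional Navier–Stokes solution `(u, p)` (`ν = 1`, `f = 0`) with
`|u| ≤ M` a.e. on `Q` and a weak spatial gradient `G` on `Q`, every spin entry
`A_{bc} = G_{bc} - G_{cb}` satisfies, against every test function `ξ` on the inner cylinder
`Q' = ]-L', 0[ × B(0, ρ')`, `|∫ ξ A_{bc}| ≤ C (|M| + M²) ‖ξ‖₂` with `C = C(R, L', ρ')` fixed before the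
solution (Serrin 1962; Chen–Strain–Tsai–Yau 2009, Lemma A.2: pressure-free interior estimates).
[folklore] -/
theorem abs_integral_test_mul_spinEntry_le {R L' ρ' : ℝ} (hR : 0 < R) (hL' : 0 < L')
    (hL : L' < 2 * R ^ 2) (hρ' : 0 < ρ') (hρ : ρ' < R) :
    ∃ C : ℝ, 0 ≤ C ∧ ∀ (M : ℝ) (u : ℝ → EuclideanSpace ℝ (Fin 3) → EuclideanSpace ℝ (Fin 3))
      (p : ℝ → EuclideanSpace ℝ (Fin 3) → ℝ)
      (G : ℝ → EuclideanSpace ℝ (Fin 3) → EuclideanSpace ℝ (Fin 3) →L[ℝ] EuclideanSpace ℝ (Fin 3)),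
      IsDistributionalNSSolutionOn
        (parabolicCylinderCenteredOpens R ((-R ^ 2 : ℝ), (0 : EuclideanSpace ℝ (Fin 3)))) 1 0 u p →
      (∀ᵐ q ∂(volume.restrict
        (parabolicCylinderCentered R ((-R ^ 2 : ℝ), (0 : EuclideanSpace ℝ (Fin 3))))), ‖u q.1 q.2‖ ≤ M) →
      HasWeakSpatialGradientOn
        (parabolicCylinderCenteredOpens R ((-R ^ 2 : ℝ), (0 : EuclideanSpace ℝ (Fin 3)))) u G →
      ∀ (b c : Fin 3) (ξ : ℝ → EuclideanSpace ℝ (Fin 3) → ℝ),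
        IsSpaceTimeTestOn (⟨Ioo (-L') 0 ×ˢ ball (0 : EuclideanSpace ℝ (Fin 3)) ρ',
          isOpen_Ioo.prod isOpen_ball⟩ : Opens (ℝ × EuclideanSpace ℝ (Fin 3))) ξ →
        |∫ q : ℝ × EuclideanSpace ℝ (Fin 3), ξ q.1 q.2 * spinEntry G b c q| ≤
          C * (|M| + M ^ 2) * Real.sqrt (∫ q : ℝ × EuclideanSpace ℝ (Fin 3), ‖ξ q.1 q.2‖ ^ 2) := by
  -- the cut-off and its constants (fixed before the solution)
  have h2R : -(2 * R ^ 2) < -L' := by linarith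
  obtain ⟨φ, hφ, hφsupp, hφ1, hφ01⟩ := HeatDivForm.exists_top_cutoff' (E := EuclideanSpace ℝ (Fin 3))
    (a := -(2 * R ^ 2)) (a' := -L') (T := 0) h2R (by linarith) hρ' hρ 0
  obtain ⟨K, hK1, hK₀, hKa, hKda, hKg, hKgg⟩ := exists_cutoff_bound hφ
  have hK0 : 0 ≤ K := by linarith
  set n : ℝ := (Module.finrank ℝ (EuclideanSpace ℝ (Fin 3)) : ℝ) with hn
  have hn0 : 0 ≤ n := Nat.cast_nonneg _
  set Lc : ℝ := 2 * R ^ 2 with hLc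
  have hLc0 : 0 < Lc := by positivity
  -- the outer cylinder
  set z₀ : ℝ × EuclideanSpace ℝ (Fin 3) := ((-R ^ 2 : ℝ), (0 : EuclideanSpace ℝ (Fin 3))) with hz₀
  set Qs : Set (ℝ × EuclideanSpace ℝ (Fin 3)) := parabolicCylinderCentered R z₀ with hQs
  have hQs_eq : Qs = Ioo (-Lc) 0 ×ˢ ball (0 : EuclideanSpace ℝ (Fin 3)) R := by
    ext q
    simp only [hQs, parabolicCylinderCentered, hz₀, mem_prod, mem_Ioo, mem_ball, hLc]
    constructor
    · rintro ⟨⟨h1, h2⟩, h3⟩; exact ⟨⟨by linarith, by linarith⟩, h3⟩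
    · rintro ⟨⟨h1, h2⟩, h3⟩; exact ⟨⟨by linarith, by linarith⟩, h3⟩
  have hQmeas : MeasurableSet Qs := (isOpen_parabolicCylinderCentered R z₀).measurableSet
  have hQfin : volume Qs < ⊤ := by
    rw [hQs_eq, Measure.volume_eq_prod, Measure.prod_prod]
    exact ENNReal.mul_lt_top (by simp [Real.volume_Ioo]) measure_ball_lt_top
  set V : ℝ := ((volume Qs) ^ (1 / 2 : ℝ)).toReal with hV
  have hV0 : 0 ≤ V := ENNReal.toReal_nonneg
  -- the constant
  set c₁ : ℝ := 3 * ((2 + 4 * n) * K) ^ 2 with hc₁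
  set c₂ : ℝ := 3 * (4 * K) ^ 2 with hc₂
  set S₀ : ℝ := 4 * Lc ^ 2 + 2 * Lc + n with hS₀
  have hS₀0 : 0 ≤ S₀ := by positivity
  set C : ℝ := V * Real.sqrt S₀ * (2 * Real.sqrt c₁ + 6 * Real.sqrt c₂) with hC
  have hC0 : 0 ≤ C := by positivity
  refine ⟨C, hC0, fun M u p G hsol hbd hG b c ξ hξ => ?_⟩
  set Qo : Opens (ℝ × EuclideanSpace ℝ (Fin 3)) := parabolicCylinderCenteredOpens R z₀ with hQo
  set Qs' : Set (ℝ × EuclideanSpace ℝ (Fin 3)) := Ioo (-L') 0 ×ˢ ball (0 : EuclideanSpace ℝ (Fin 3)) ρ'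
    with hQs'
  have hQ'Q : Qs' ⊆ Qs := by
    rw [hQs_eq]; exact prod_mono (Ioo_subset_Ioo h2R.le le_rfl) (ball_subset_ball hρ.le)
  have hQoQ : (⟨Qs', isOpen_Ioo.prod isOpen_ball⟩ : Opens (ℝ × EuclideanSpace ℝ (Fin 3))) ≤ Qo := hQ'Q
  have hξQ : IsSpaceTimeTestOn Qo ξ := hξ.mono hQoQ
  have hξtop : IsSpaceTimeTestOn (⊤ : Opens (ℝ × EuclideanSpace ℝ (Fin 3))) ξ := hξ.mono le_top
  have hu : LocallyIntegrableOn (uncurry u) Qs volume := hsol.1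
  have hbd' : ∀ᵐ q ∂(volume.restrict Qs), ‖u q.1 q.2‖ ≤ |M| := hbd.mono fun q hq => hq.trans (le_abs_self M)
  -- Step 1: the Duhamel field, the localised test function `ψ = φ U`
  obtain ⟨a₀, b₀, -, hb₀, hab₀⟩ := HeatDivForm.exists_time_support_lt_top (E := EuclideanSpace ℝ (Fin 3))
    (T := 0) (ψ := ξ) hξ.hasCompactSupport (fun q hq => (hξ.tsupport_subset hq).1.2)
  set U : ℝ → EuclideanSpace ℝ (Fin 3) → ℝ := heatDuhamelBack 1 ξ with hU
  have hUs : ContDiff ℝ ((⊤ : ℕ∞) : WithTop ℕ∞) (uncurry U) :=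
    hξtop.contDiff_uncurry_heatDuhamelBack_infty one_pos
  have hU2 : ∀ t, ContDiff ℝ 2 (U t) := fun t => (contDiff_slice_of_uncurry hUs t).of_le two_le_infty
  have hU0 : ∀ s, b₀ ≤ s → ∀ x, U s x = 0 := fun s hs x =>
    hξtop.heatDuhamelBack_eq_zero_of_le one_pos hab₀ hs x
  set ψ : ℝ → EuclideanSpace ℝ (Fin 3) → ℝ := fun t x => φ t x * U t x with hψ_def
  have hψ : IsSpaceTimeTestOn Qo ψ := by
    refine HeatDivForm.isSpaceTimeTestOn_mul_of_eq_zero_of_le hφ hUs hU0 fun q hq hqb => ?_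
    obtain ⟨hq1, hq2⟩ := hφsupp q hq
    show q ∈ Qs
    rw [hQs_eq]
    refine ⟨⟨by linarith, by linarith⟩, ?_⟩
    rw [mem_ball]; linarith
  -- Step 2: `φ ξ = ξ`, the remainder `ϑ`, and `∂ₜψ + Δψ = -ξ + ϑ`
  have hφξ : ∀ t x, φ t x * ξ t x = ξ t x := by
    intro t x
    by_cases hx : ξ t x = 0
    · rw [hx, mul_zero]
    · have hq : (t, x) ∈ Qs' := hξ.tsupport_subset (subset_tsupport _ (by exact hx))
      rw [hφ1 (t, x) ⟨hq.1.1.le, by linarith [hq.1.2]⟩ hq.2, one_mul]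
  set ϑ : ℝ → EuclideanSpace ℝ (Fin 3) → ℝ := fun t x =>
    (timeDeriv φ t x + (Δ (φ t)) x) * U t x +
      2 * ∑ i, fderiv ℝ (φ t) x (stdOrthonormalBasis ℝ (EuclideanSpace ℝ (Fin 3)) i) *
        fderiv ℝ (U t) x (stdOrthonormalBasis ℝ (EuclideanSpace ℝ (Fin 3)) i) with hϑ_def
  have hheat : ∀ t x, NSSpinHeat.heatTest ψ t x = -ξ t x + ϑ t x := by
    intro t x
    rw [NSSpinHeat.heatTest_apply]
    have h := heat_cutoff_duhamel hφ hξtop t x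
    rw [hφξ t x] at h
    exact h
  have hϑeq : ϑ = fun t x => NSSpinHeat.heatTest ψ t x + ξ t x := by
    funext t x; rw [hheat t x]; ring
  have hϑt : IsSpaceTimeTestOn Qo ϑ := by
    rw [hϑeq]; exact NSSpinHeat.isSpaceTimeTestOn_add (NSSpinHeat.isSpaceTimeTestOn_heatTest hψ) hξQ
  -- the derived test functions
  have hDϑ : ∀ c' : Fin 3, IsSpaceTimeTestOn Qo (fun t x => fderiv ℝ (ϑ t) x (EuclideanSpace.single c' (1 : ℝ))) :=
    fun c' => NSSpinHeat.isSpaceTimeTestOn_fderiv_apply hϑt _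
  have hDξ : ∀ c' : Fin 3, IsSpaceTimeTestOn Qo (fun t x => fderiv ℝ (ξ t) x (EuclideanSpace.single c' (1 : ℝ))) :=
    fun c' => NSSpinHeat.isSpaceTimeTestOn_fderiv_apply hξQ _
  have hDψ : ∀ c' : Fin 3, IsSpaceTimeTestOn Qo (fun t x => fderiv ℝ (ψ t) x (EuclideanSpace.single c' (1 : ℝ))) :=
    fun c' => NSSpinHeat.isSpaceTimeTestOn_fderiv_apply hψ _
  have hDDψ : ∀ c' j : Fin 3, IsSpaceTimeTestOn Qo (fun t x =>
      fderiv ℝ (fun y => fderiv ℝ (ψ t) y (EuclideanSpace.single c' (1 : ℝ))) x (EuclideanSpace.single j (1 : ℝ))) :=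
    fun c' j => NSSpinHeat.isSpaceTimeTestOn_fderiv_apply (hDψ c') _
  -- `∂(∂ₜψ + Δψ) = -∂ξ + ∂ϑ`
  have hDheat : ∀ (c' : Fin 3) (q : ℝ × EuclideanSpace ℝ (Fin 3)),
      fderiv ℝ (NSSpinHeat.heatTest ψ q.1) q.2 (EuclideanSpace.single c' (1 : ℝ)) =
        -fderiv ℝ (ξ q.1) q.2 (EuclideanSpace.single c' (1 : ℝ)) +
          fderiv ℝ (ϑ q.1) q.2 (EuclideanSpace.single c' (1 : ℝ)) := by
    intro c' q
    have e : NSSpinHeat.heatTest ψ q.1 = fun x => -ξ q.1 x + ϑ q.1 x := funext (hheat q.1)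
    have hdξ : DifferentiableAt ℝ (ξ q.1) q.2 := ((hξ.contDiff_slice q.1).differentiable (by simp)) q.2
    have hdϑ : DifferentiableAt ℝ (ϑ q.1) q.2 := ((hϑt.contDiff_slice q.1).differentiable (by simp)) q.2
    rw [e, fderiv_fun_add hdξ.fun_neg hdϑ, fderiv_fun_neg]
    simp only [_root_.add_apply, FunLike.coe_neg, Pi.neg_apply]
  -- Step 3: the momentum identity and the weak-gradient identity
  have key := NSSpinHeat.momentum_pairField hsol hbd hψ b c
  have hI : ∫ q : ℝ × EuclideanSpace ℝ (Fin 3), ξ q.1 q.2 * spinEntry G b c q =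
      (-∫ q : ℝ × EuclideanSpace ℝ (Fin 3), fderiv ℝ (ξ q.1) q.2 (EuclideanSpace.single c (1 : ℝ)) *
          NSSpinHeat.velC u b q) +
        ∫ q : ℝ × EuclideanSpace ℝ (Fin 3), fderiv ℝ (ξ q.1) q.2 (EuclideanSpace.single b (1 : ℝ)) *
          NSSpinHeat.velC u c q := by
    have h1 := NSSpinHeat.integral_test_mul_gradE hG hξQ b c
    have h2 := NSSpinHeat.integral_test_mul_gradE hG hξQ c b
    have i1 : Integrable (fun q : ℝ × EuclideanSpace ℝ (Fin 3) => ξ q.1 q.2 * NSSpinHeat.gradE G b c q) :=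
      NSSpinHeat.integrable_test_mul (NSSpinHeat.locallyIntegrableOn_gradE hG.locallyIntegrableOn_grad b c) hξQ
    have i2 : Integrable (fun q : ℝ × EuclideanSpace ℝ (Fin 3) => ξ q.1 q.2 * NSSpinHeat.gradE G c b q) :=
      NSSpinHeat.integrable_test_mul (NSSpinHeat.locallyIntegrableOn_gradE hG.locallyIntegrableOn_grad c b) hξQ
    have e : (fun q : ℝ × EuclideanSpace ℝ (Fin 3) => ξ q.1 q.2 * spinEntry G b c q) =
        fun q => ξ q.1 q.2 * NSSpinHeat.gradE G b c q - ξ q.1 q.2 * NSSpinHeat.gradE G c b q := by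
      funext q; simp only [spinEntry, NSSpinHeat.gradE_apply]; ring
    rw [e, integral_sub i1 i2, h1, h2]
    ring
  -- integrability of the pieces
  have iDξ : ∀ c' b' : Fin 3, Integrable (fun q : ℝ × EuclideanSpace ℝ (Fin 3) =>
      fderiv ℝ (ξ q.1) q.2 (EuclideanSpace.single c' (1 : ℝ)) * NSSpinHeat.velC u b' q) :=
    fun c' b' => NSSpinHeat.integrable_test_mul (NSSpinHeat.locallyIntegrableOn_velC hu b') (hDξ c')
  have iDϑ : ∀ c' b' : Fin 3, Integrable (fun q : ℝ × EuclideanSpace ℝ (Fin 3) =>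
      fderiv ℝ (ϑ q.1) q.2 (EuclideanSpace.single c' (1 : ℝ)) * NSSpinHeat.velC u b' q) :=
    fun c' b' => NSSpinHeat.integrable_test_mul (NSSpinHeat.locallyIntegrableOn_velC hu b') (hDϑ c')
  have iDDψ : ∀ c' j b' : Fin 3, Integrable (fun q : ℝ × EuclideanSpace ℝ (Fin 3) =>
      fderiv ℝ (fun y => fderiv ℝ (ψ q.1) y (EuclideanSpace.single c' (1 : ℝ))) q.2
        (EuclideanSpace.single j (1 : ℝ)) * (NSSpinHeat.velC u j q * NSSpinHeat.velC u b' q)) :=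
    fun c' j b' => NSSpinHeat.integrable_test_mul (NSSpinHeat.locallyIntegrableOn_velC_mul_velC hu hbd j b')
      (hDDψ c' j)
  -- splitting `∫ ∂(∂ₜψ + Δψ) u` into the `ξ` part and the `ϑ` part
  have hsplit : ∀ c' b' : Fin 3, ∫ q : ℝ × EuclideanSpace ℝ (Fin 3),
      fderiv ℝ (NSSpinHeat.heatTest ψ q.1) q.2 (EuclideanSpace.single c' (1 : ℝ)) * NSSpinHeat.velC u b' q =
      (-∫ q : ℝ × EuclideanSpace ℝ (Fin 3),
          fderiv ℝ (ξ q.1) q.2 (EuclideanSpace.single c' (1 : ℝ)) * NSSpinHeat.velC u b' q) +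
        ∫ q : ℝ × EuclideanSpace ℝ (Fin 3),
          fderiv ℝ (ϑ q.1) q.2 (EuclideanSpace.single c' (1 : ℝ)) * NSSpinHeat.velC u b' q := by
    intro c' b'
    have i1 : Integrable (fun q : ℝ × EuclideanSpace ℝ (Fin 3) =>
        -(fderiv ℝ (ξ q.1) q.2 (EuclideanSpace.single c' (1 : ℝ)) * NSSpinHeat.velC u b' q)) :=
      (iDξ c' b').neg
    have e1 : (fun q : ℝ × EuclideanSpace ℝ (Fin 3) =>
        fderiv ℝ (NSSpinHeat.heatTest ψ q.1) q.2 (EuclideanSpace.single c' (1 : ℝ)) * NSSpinHeat.velC u b' q) =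
        fun q => -(fderiv ℝ (ξ q.1) q.2 (EuclideanSpace.single c' (1 : ℝ)) * NSSpinHeat.velC u b' q) +
          fderiv ℝ (ϑ q.1) q.2 (EuclideanSpace.single c' (1 : ℝ)) * NSSpinHeat.velC u b' q := by
      funext q; rw [hDheat c' q]; ring
    rw [e1, integral_add i1 (iDϑ c' b'), integral_neg]
  -- the sums over `j`
  have hsumN : ∀ c' b' : Fin 3, ∫ q : ℝ × EuclideanSpace ℝ (Fin 3), ∑ j,
      fderiv ℝ (fun y => fderiv ℝ (ψ q.1) y (EuclideanSpace.single c' (1 : ℝ))) q.2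
        (EuclideanSpace.single j (1 : ℝ)) * (NSSpinHeat.velC u j q * NSSpinHeat.velC u b' q) =
      ∑ j, ∫ q : ℝ × EuclideanSpace ℝ (Fin 3),
        fderiv ℝ (fun y => fderiv ℝ (ψ q.1) y (EuclideanSpace.single c' (1 : ℝ))) q.2
          (EuclideanSpace.single j (1 : ℝ)) * (NSSpinHeat.velC u j q * NSSpinHeat.velC u b' q) :=
    fun c' b' => integral_finsetSum _ fun j _ => iDDψ c' j b'
  rw [hsplit c b, hsplit b c, hsumN c b, hsumN b c] at key
  -- Step 4: the energy density and the slab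
  set e : ℝ × EuclideanSpace ℝ (Fin 3) → ℝ := fun q => ‖U q.1 q.2‖ ^ 2 +
    ∑ i, ‖fderiv ℝ (U q.1) q.2 (stdOrthonormalBasis ℝ (EuclideanSpace ℝ (Fin 3)) i)‖ ^ 2 +
    ∑ i, ∑ j, ‖fderiv ℝ (fun y => fderiv ℝ (U q.1) y (stdOrthonormalBasis ℝ (EuclideanSpace ℝ (Fin 3)) i)) q.2
      (stdOrthonormalBasis ℝ (EuclideanSpace ℝ (Fin 3)) j)‖ ^ 2 with he_def
  obtain ⟨heI, heS⟩ := slab_energy_le hξtop hab₀ hb₀.le hLc0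
  obtain ⟨Iξ, hIξ_def⟩ : ∃ I : ℝ, I = ∫ q : ℝ × EuclideanSpace ℝ (Fin 3), ‖ξ q.1 q.2‖ ^ 2 := ⟨_, rfl⟩
  rw [← hIξ_def] at heS ⊢
  have hIξ0 : 0 ≤ Iξ := by rw [hIξ_def]; exact integral_nonneg fun _ => by positivity
  -- pointwise: `R(q)² ≤ 3 e(q)`
  have hRe : ∀ q : ℝ × EuclideanSpace ℝ (Fin 3),
      (‖U q.1 q.2‖ + ‖fderiv ℝ (U q.1) q.2‖ + ‖fderiv ℝ (fderiv ℝ (U q.1)) q.2‖) ^ 2 ≤ 3 * e q :=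
    fun q => pointwise_size_sq_le (U q.1) q.2
  have hsingle : ∀ j : Fin 3, ‖(EuclideanSpace.single j (1 : ℝ) : EuclideanSpace ℝ (Fin 3))‖ = 1 :=
    fun j => by simp
  -- pointwise bound for `∂ϑ`
  have hDϑ_pt : ∀ (c' : Fin 3) (q : ℝ × EuclideanSpace ℝ (Fin 3)),
      ‖fderiv ℝ (ϑ q.1) q.2 (EuclideanSpace.single c' (1 : ℝ))‖ ^ 2 ≤ c₁ * e q := by
    intro c' q
    have h := (fderiv_remainder_bound hφ hK1 hKa hKda hKg hKgg (hU2 q.1) q.1 q.2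
      (EuclideanSpace.single c' (1 : ℝ))).2
    rw [hsingle, mul_one] at h
    have h0 : 0 ≤ (2 + 4 * n) * K := by positivity
    calc ‖fderiv ℝ (ϑ q.1) q.2 (EuclideanSpace.single c' (1 : ℝ))‖ ^ 2
        ≤ ((2 + 4 * n) * K * (‖U q.1 q.2‖ + ‖fderiv ℝ (U q.1) q.2‖ + ‖fderiv ℝ (fderiv ℝ (U q.1)) q.2‖)) ^ 2 :=
          pow_le_pow_left₀ (norm_nonneg _) h 2
      _ = ((2 + 4 * n) * K) ^ 2 * (‖U q.1 q.2‖ + ‖fderiv ℝ (U q.1) q.2‖ + ‖fderiv ℝ (fderiv ℝ (U q.1)) q.2‖) ^ 2 := by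
          ring
      _ ≤ ((2 + 4 * n) * K) ^ 2 * (3 * e q) := mul_le_mul_of_nonneg_left (hRe q) (by positivity)
      _ = c₁ * e q := by rw [hc₁]; ring
  -- pointwise bound for `∂∂ψ`
  have hDDψ_pt : ∀ (c' j : Fin 3) (q : ℝ × EuclideanSpace ℝ (Fin 3)),
      ‖fderiv ℝ (fun y => fderiv ℝ (ψ q.1) y (EuclideanSpace.single c' (1 : ℝ))) q.2
        (EuclideanSpace.single j (1 : ℝ))‖ ^ 2 ≤ c₂ * e q := by
    intro c' j q
    have hφ2 : ContDiff ℝ 2 (φ q.1) := (hφ.contDiff_slice q.1).of_le two_le_infty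
    have h := fderiv_fderiv_mul_bound hφ2 (hU2 q.1) hK1 (hK₀ q.1) (hKg q.1) (hKgg q.1) q.2
      (EuclideanSpace.single c' (1 : ℝ)) (EuclideanSpace.single j (1 : ℝ))
    rw [hsingle, hsingle, mul_one, mul_one] at h
    have h0 : 0 ≤ 4 * K := by positivity
    calc ‖fderiv ℝ (fun y => fderiv ℝ (ψ q.1) y (EuclideanSpace.single c' (1 : ℝ))) q.2
          (EuclideanSpace.single j (1 : ℝ))‖ ^ 2
        ≤ (4 * K * (‖U q.1 q.2‖ + ‖fderiv ℝ (U q.1) q.2‖ + ‖fderiv ℝ (fderiv ℝ (U q.1)) q.2‖)) ^ 2 :=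
          pow_le_pow_left₀ (norm_nonneg _) h 2
      _ = (4 * K) ^ 2 * (‖U q.1 q.2‖ + ‖fderiv ℝ (U q.1) q.2‖ + ‖fderiv ℝ (fderiv ℝ (U q.1)) q.2‖) ^ 2 := by
          ring
      _ ≤ (4 * K) ^ 2 * (3 * e q) := mul_le_mul_of_nonneg_left (hRe q) (by positivity)
      _ = c₂ * e q := by rw [hc₂]; ring
  -- Step 5: the data `u_b`, `u_j u_b` are a.e. bounded on `Q`, and `Q` lies in the slab
  have hvelm : ∀ b' : Fin 3, AEStronglyMeasurable (NSSpinHeat.velC u b') (volume.restrict Qs) :=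
    fun b' => (NSSpinHeat.locallyIntegrableOn_velC hu b').aestronglyMeasurable
  have hvel_bd : ∀ b' : Fin 3, ∀ᵐ q ∂(volume.restrict Qs), ‖NSSpinHeat.velC u b' q‖ ≤ |M| := fun b' =>
    hbd'.mono fun q hq => (PiLp.norm_apply_le (u q.1 q.2) b').trans hq
  have hvv_bd : ∀ j b' : Fin 3, ∀ᵐ q ∂(volume.restrict Qs),
      ‖NSSpinHeat.velC u j q * NSSpinHeat.velC u b' q‖ ≤ M ^ 2 := fun j b' =>
    hbd'.mono fun q hq => by
      rw [norm_mul]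
      have h1 := (PiLp.norm_apply_le (u q.1 q.2) j).trans hq
      have h2 := (PiLp.norm_apply_le (u q.1 q.2) b').trans hq
      calc ‖NSSpinHeat.velC u j q‖ * ‖NSSpinHeat.velC u b' q‖ ≤ |M| * |M| :=
            mul_le_mul h1 h2 (norm_nonneg _) (abs_nonneg _)
        _ = M ^ 2 := by rw [← sq, sq_abs]
  have hQsL : ∀ q ∈ Qs, q.1 ∈ Ioo (-Lc) 0 := fun q hq => by rw [hQs_eq] at hq; exact hq.1
  have hM0 : 0 ≤ |M| := abs_nonneg M
  -- Step 6: the four bounds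
  have hX : ∀ c' b' : Fin 3, |∫ q : ℝ × EuclideanSpace ℝ (Fin 3),
      fderiv ℝ (ϑ q.1) q.2 (EuclideanSpace.single c' (1 : ℝ)) * NSSpinHeat.velC u b' q| ≤
      V * |M| * (Real.sqrt c₁ * Real.sqrt (S₀ * Iξ)) := fun c' b' =>
    abs_integral_test_mul_bounded_le hQmeas hQfin hQsL (hvelm b') hM0 (hvel_bd b')
      (hDϑ c').contDiff.continuous (fun q hq => (hDϑ c').apply_eq_zero fun h => hq h) heI
      (by positivity : (0 : ℝ) ≤ c₁) (hDϑ_pt c') heS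
  have hN : ∀ c' j b' : Fin 3, |∫ q : ℝ × EuclideanSpace ℝ (Fin 3),
      fderiv ℝ (fun y => fderiv ℝ (ψ q.1) y (EuclideanSpace.single c' (1 : ℝ))) q.2
        (EuclideanSpace.single j (1 : ℝ)) * (NSSpinHeat.velC u j q * NSSpinHeat.velC u b' q)| ≤
      V * M ^ 2 * (Real.sqrt c₂ * Real.sqrt (S₀ * Iξ)) := fun c' j b' =>
    abs_integral_test_mul_bounded_le hQmeas hQfin hQsL ((hvelm j).mul (hvelm b')) (sq_nonneg M)
      (hvv_bd j b') (hDDψ c' j).contDiff.continuous (fun q hq => (hDDψ c' j).apply_eq_zero fun h => hq h)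
      heI (by positivity : (0 : ℝ) ≤ c₂) (hDDψ_pt c' j) heS
  -- Step 7: assemble
  have hsq : Real.sqrt (S₀ * Iξ) = Real.sqrt S₀ * Real.sqrt Iξ := Real.sqrt_mul hS₀0 Iξ
  rw [hI]
  have habs : ∀ c' b' : Fin 3, |∑ j, ∫ q : ℝ × EuclideanSpace ℝ (Fin 3),
      fderiv ℝ (fun y => fderiv ℝ (ψ q.1) y (EuclideanSpace.single c' (1 : ℝ))) q.2
        (EuclideanSpace.single j (1 : ℝ)) * (NSSpinHeat.velC u j q * NSSpinHeat.velC u b' q)| ≤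
      3 * (V * M ^ 2 * (Real.sqrt c₂ * Real.sqrt (S₀ * Iξ))) := by
    intro c' b'
    refine (Finset.abs_sum_le_sum_abs _ _).trans ?_
    calc ∑ j, |∫ q : ℝ × EuclideanSpace ℝ (Fin 3),
          fderiv ℝ (fun y => fderiv ℝ (ψ q.1) y (EuclideanSpace.single c' (1 : ℝ))) q.2
            (EuclideanSpace.single j (1 : ℝ)) * (NSSpinHeat.velC u j q * NSSpinHeat.velC u b' q)|
        ≤ ∑ _j : Fin 3, V * M ^ 2 * (Real.sqrt c₂ * Real.sqrt (S₀ * Iξ)) :=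
          Finset.sum_le_sum fun j _ => hN c' j b'
      _ = 3 * (V * M ^ 2 * (Real.sqrt c₂ * Real.sqrt (S₀ * Iξ))) := by
          rw [Finset.sum_const, Finset.card_univ, Fintype.card_fin, nsmul_eq_mul]; norm_num
  -- from `key`: `(I₁ - I₂) = X₁ - X₂ + N₁ - N₂`
  have hX1 := hX c b
  have hX2 := hX b c
  have hN1' := habs c b
  have hN2' := habs b c
  set I₁ := ∫ q : ℝ × EuclideanSpace ℝ (Fin 3),
    fderiv ℝ (ξ q.1) q.2 (EuclideanSpace.single c (1 : ℝ)) * NSSpinHeat.velC u b q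
  set I₂ := ∫ q : ℝ × EuclideanSpace ℝ (Fin 3),
    fderiv ℝ (ξ q.1) q.2 (EuclideanSpace.single b (1 : ℝ)) * NSSpinHeat.velC u c q
  set X₁ := ∫ q : ℝ × EuclideanSpace ℝ (Fin 3),
    fderiv ℝ (ϑ q.1) q.2 (EuclideanSpace.single c (1 : ℝ)) * NSSpinHeat.velC u b q
  set X₂ := ∫ q : ℝ × EuclideanSpace ℝ (Fin 3),
    fderiv ℝ (ϑ q.1) q.2 (EuclideanSpace.single b (1 : ℝ)) * NSSpinHeat.velC u c q
  set N₁ := ∑ j, ∫ q : ℝ × EuclideanSpace ℝ (Fin 3),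
    fderiv ℝ (fun y => fderiv ℝ (ψ q.1) y (EuclideanSpace.single c (1 : ℝ))) q.2
      (EuclideanSpace.single j (1 : ℝ)) * (NSSpinHeat.velC u j q * NSSpinHeat.velC u b q)
  set N₂ := ∑ j, ∫ q : ℝ × EuclideanSpace ℝ (Fin 3),
    fderiv ℝ (fun y => fderiv ℝ (ψ q.1) y (EuclideanSpace.single b (1 : ℝ))) q.2
      (EuclideanSpace.single j (1 : ℝ)) * (NSSpinHeat.velC u j q * NSSpinHeat.velC u c q)
  have key' : -(-I₁ + X₁) + (-I₂ + X₂) - N₁ + N₂ = 0 := key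
  have hid : -I₁ + I₂ = -X₁ + X₂ - N₁ + N₂ := by linear_combination (-1 : ℝ) * key'
  rw [hid]
  calc |-X₁ + X₂ - N₁ + N₂| ≤ |X₁| + |X₂| + |N₁| + |N₂| := by
        have h1 : |-X₁ + X₂ - N₁ + N₂| ≤ |-X₁ + X₂ - N₁| + |N₂| := abs_add_le _ _
        have h2 : |-X₁ + X₂ - N₁| ≤ |-X₁ + X₂| + |N₁| := abs_sub _ _
        have h3 : |-X₁ + X₂| ≤ |-X₁| + |X₂| := abs_add_le _ _
        rw [abs_neg] at h3
        linarith
    _ ≤ V * |M| * (Real.sqrt c₁ * Real.sqrt (S₀ * Iξ)) + V * |M| * (Real.sqrt c₁ * Real.sqrt (S₀ * Iξ)) +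
          3 * (V * M ^ 2 * (Real.sqrt c₂ * Real.sqrt (S₀ * Iξ))) +
          3 * (V * M ^ 2 * (Real.sqrt c₂ * Real.sqrt (S₀ * Iξ))) :=
        add_le_add (add_le_add (add_le_add hX1 hX2) hN1') hN2'
    _ = V * Real.sqrt S₀ * (2 * Real.sqrt c₁ * |M| + 6 * Real.sqrt c₂ * M ^ 2) * Real.sqrt Iξ := by
        rw [hsq]; ring
    _ ≤ C * (|M| + M ^ 2) * Real.sqrt Iξ := by
        rw [hC]
        refine mul_le_mul_of_nonneg_right ?_ (Real.sqrt_nonneg _)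
        have h1 : 2 * Real.sqrt c₁ * |M| + 6 * Real.sqrt c₂ * M ^ 2 ≤
            (2 * Real.sqrt c₁ + 6 * Real.sqrt c₂) * (|M| + M ^ 2) := by
          nlinarith [Real.sqrt_nonneg c₁, Real.sqrt_nonneg c₂, hM0, sq_nonneg M,
            mul_nonneg (Real.sqrt_nonneg c₁) (sq_nonneg M), mul_nonneg (Real.sqrt_nonneg c₂) hM0]
        calc V * Real.sqrt S₀ * (2 * Real.sqrt c₁ * |M| + 6 * Real.sqrt c₂ * M ^ 2)
            ≤ V * Real.sqrt S₀ * ((2 * Real.sqrt c₁ + 6 * Real.sqrt c₂) * (|M| + M ^ 2)) :=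
              mul_le_mul_of_nonneg_left h1 (by positivity)
          _ = V * Real.sqrt S₀ * (2 * Real.sqrt c₁ + 6 * Real.sqrt c₂) * (|M| + M ^ 2) := by ring


end Serrin

end Summit.NavierStokesRegularity.NavierStokesRegularity.Theorems.ScalingDefectPeepholeDoor

end
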